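import Summits.BirchSwinnertonDyer.BirchSwinnertonDyer.Theorems.EisensteinPrimesAcTwistDeformationLocSurj
import Summits.BirchSwinnertonDyer.BirchSwinnertonDyer.Theorems.EisensteinPrimesAcTwistDeformationResidualPair
import Summits.BirchSwinnertonDyer.BirchSwinnertonDyer.Theorems.UniversalToricDescentSigmaLocalStabilizer
import HarnessLib

/-!
# Route `EisensteinPrimes` (rung K5), crux 2 `GoodLatticeBDPValue`, line `halves` v19.1, V21 INDEX ROAD input
# S1 = SUR_θ AT `v̄`: the `K_∞`-side global-to-local surjectivity
# `H¹(K_Σ/K_∞, (F/𝒪)(θ)) ↠ ⊕_{j<s} H¹(K_{∞,w_j}, (F/𝒪)(θ))` at the `s = p^c` places `w_j` of `K_∞` above `v̄`,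
# IN THE KERNEL from `SUR(𝐃₁(θ), 𝓛_v)` (helper for stmt-BirchSwinnertonDyer-19032)

Cell `bsd-eis` (home `run/shared/lean/pub/bsd-eis/`), seat `bsd-line-x1-p1-w3` gen 3 (D-0154 width seat on
crux 2 `GoodLatticeBDPValue`, line `halves` v19.1; LEAD g4's V21 index road
`Cruxes/GoodLatticeBDPValue/Lines/halves-imprimLambda-index-road.md` §3 bullet 1 / §4 S1). The road computes
KY Thm. 1.4.1 (iii) by an index bookkeeping whose step (1) needs, for `A = (F/𝒪)(θsub)`, `(F/𝒪)(θquot)`, the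
exactness on the right of `0 → S(A) → U(A) → P(A) → 0`, `U(A) = H¹(Gal(K_Σ/K_∞), A)` (classes of
`H¹(ker κ, A)` unramified outside `Σ = Sf ∪ {v, v̄}`; the tree's `GreenbergVatsal2000.unramifiedOutside`),
`P(A) = ⊕_{j<s} H¹(G_j, A)` over the `s = [Γ : Γ_v̄] = p^c` places of `K_∞` above `v̄`. LEAD g2's road (A)
(`…AcTwistDeformation{Cofree,LEO,SUR,Shapiro,Cotorsion,LocalShapiro,LocalClasses,LocSurj}`) derived exactly
this surjectivity at the places `w ∈ S₀ ⊆ Sf` (`w ∤ p`) from Greenberg's `SUR(𝐃₁, 𝓛_v)` for the one-variable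
twist deformation `𝐃₁ = A ⊗ Λ^*(κ⁻¹)` through Shapiro's lemma; every ingredient of that derivation — local
Shapiro surjectivity on `Γ_{K_w}` (`exists_localCocycle_forall_eval`), the evaluation classes of the
conjugated descent (`resOfLe_conjH1_shapiroDescent_eq`), the landing lemmas (`conjH1_shapiroDescent_mem_awayKer_of_loc_eq_zero`,
`…_mem_unramifiedKer_of_not_mem`) — is PLACE-AGNOSTIC; only the final membership in `H¹_{𝓕_nr^{S₀}}`
(unramified at `v̄`) used `w ∤ p`. THIS FILE runs the same proof with a target set `S₀ ⊆ S ∖ {v}` that MAY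
CONTAIN `v̄`:

* §1 **`exists_mem_unramifiedOutside_forall_resOfLe_conjH1_eq`** — generic (`K` imaginary quadratic, `p = v v̄`,
  `A ≃ ℚ_p/ℤ_p` with scalar `G_{K,S}`-action `ρ₀ ↔ M` via `ψ`, `S ⊇ {v, v̄}` finite with `κ(D_w) ≠ 1` on `S`,
  `corank_Λ S_{𝓛_v}(K, 𝐃₁) = 0`; the five Greenberg facts BY NAME): for a finite `S₀ ⊆ S ∖ {v}` with
  `κ(D_w) = p^{a_w} ℤ_p` exactly, representatives `σ_{w,i}` (`κ(σ_{w,i}) = i`, `i < p^{a_w}`) and ANY targets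
  `y_{w,i} ∈ H¹(ker κ ⊓ D_w, M)`, there is `u ∈ H¹(ker κ, M)` UNRAMIFIED OUTSIDE `S₀ ∪ {w ∣ p}`
  (`unramifiedOutside κ.kerSubgroup M p ↑S₀`), LOCALLY TRIVIAL above every `w ∈ S ∖ ({v} ∪ S₀)` (all conjugates
  in `awayKer w`; in particular strict at `v̄` when `v̄ ∉ S₀`), with `res_{ker κ ⊓ D_w}(conj_{σ_{w,i}} u) = y_{w,i}`.
* §2 **`exists_forall_resOfLe_conjH1_pow_eq_at_vbar_of_RH`** — the instantiation at a character `θ` of the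
  residual pair with `S₀ = {v̄}`, representatives `γ^i` (`κ(γ^i) = i`), under the binders the crux's
  consumers use (`W/ℚ`, `K` imaginary quadratic with (Heeg) for `N_E`, `2 < p`, `v ≠ v̄` above `p`, `κ`
  anticyclotomic with topological generator `γ`, `θ ∈ {θsub, θquot}` of `IsResidualPairOver (W/K) p θsub θquot`,
  `Sf` = places over `N_E`, [RH] for `θ`): **there is `c` with `κ(D_v̄) = p^c ℤ_p` exactly and, for every
  `y : ℕ → H¹(ker κ ⊓ D_v̄, (F/𝒪)(θ))`, some `u ∈ unramifiedOutside κ.kerSubgroup ((F/𝒪)(θ)) p ↑Sf` (= `U(A_θ)`),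
  locally trivial above every `w ∈ Sf`, with `res_{ker κ ⊓ D_v̄}(conj_{γ^i} u) = y i` for all `i < p^c`** — the
  road's SUR_θ (with `u` even strict at `Sf`).

Theorems only; conditional only through the by-name published facts fed to `bigRep_fullAt_SUR`
(`prop263_sur_of_crk`, Greenberg 2006 Props. 4.1/4.2/§5A/3.2) and [RH]; no definition, no named fact, no
`sorry`. HONEST FRAMING: closes nothing by itself (`--supports`); no summit statement, BSD / IMC2 / KY Thm.
1.4.1 (iii) is proved for no curve by this file. References: [Greenberg2016Selmer] Prop. 2.6.3, §1 p. 3;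
[PollackWeston2011] App. A Prop. A.2 (the same surjectivity over `K_∞`, at ALL places of `Σ`); [KellerYin2024]
Rem. 1.2.3 (ii), Rem. 1.4.2 (`surj for Self`) (arXiv:2402.12781v2 TeX L690–712, L1130–1140); [SkinnerUrban2014]
§3.1.2, Prop. 3.2.3; [GreenbergVatsal2000] §2 pp. 16–17.
-/

set_option autoImplicit false
set_option linter.dupNamespace false

noncomputable section

open scoped Classical
open NumberField IsDedekindDomain Field Multiplicative PowerSeries WeierstrassCurve
open Literature.NumberTheory.EllipticCurves Literature.NumberTheory.EllipticCurves.GreenbergSelmer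
  Literature.NumberTheory.EllipticCurves.GreenbergVatsal2000 Literature.NumberTheory.GaloisRepresentations
  Literature.NumberTheory.EllipticCurves.KellerYin2024 Literature.NumberTheory.EllipticCurves.IwasawaDual
  Literature.NumberTheory.IwasawaTheory Literature.NumberTheory.IwasawaTheory.Greenberg2016
  Literature.NumberTheory.IwasawaTheory.Greenberg2006
  Summit.BirchSwinnertonDyer.BirchSwinnertonDyer.Theorems.GreenbergFullAtSelmer
  Summit.BirchSwinnertonDyer.BirchSwinnertonDyer.Theorems.AcTwistDeformationResidualPair

namespace Summit.BirchSwinnertonDyer.BirchSwinnertonDyer.Theorems.AcTwistDeformation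

/-! ## §1 The generic surjectivity with targets at `S₀ ⊆ S ∖ {v}` (possibly `v̄ ∈ S₀`) -/

section SurAt

variable {K : Type} [Field K] [NumberField K] (S : Set (HeightOneSpectrum (𝓞 K))) {p : ℕ} [Fact p.Prime]
  {A : Type} [AddCommGroup A] [Module ℤ_[p] A] [TopologicalSpace A] [DiscreteTopology A]
  [TopologicalSpace (PowerSeries ℤ_[p])] [IsTopologicalRing (PowerSeries ℤ_[p])]
  [IsTopologicalAddGroup (BigRepModule ℤ_[p] p A)] [ContinuousSMul (PowerSeries ℤ_[p]) (BigRepModule ℤ_[p] p A)]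
  (hS : ∀ v : HeightOneSpectrum (𝓞 K), ((p : ℕ) : 𝓞 K) ∈ v.asIdeal → v ∈ S)
  (κ : ZpExtension K p) (ρ₀ : ContinuousRep (GaloisGroupUnramifiedOutside K S) ℤ_[p] A)
  {M : Type} [AddCommGroup M] [DistribMulAction (absoluteGaloisGroup K) M] [TopologicalSpace M]
  [DiscreteTopology M]
  (ψ : A ≃+ M) (hψ : ∀ (σ : absoluteGaloisGroup K) (a : A), ψ (ρ₀ (toUnramifiedQuot K S σ) a) = σ • ψ a)

include hψ in
/-- **`K_∞`-SIDE GLOBAL-TO-LOCAL SURJECTIVITY WITH TARGETS AT ANY `S₀ ⊆ S ∖ {v}` — `v̄` ALLOWED.**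
Hypotheses: those of `bigRep_fullAt_SUR` (Greenberg 2016 Prop. 2.6.3 and Greenberg 2006 §3–5 BY NAME;
`K` imaginary quadratic; `A ≃ ℚ_p/ℤ_p` with scalar action; `S` finite, `⊇ {w ∣ p} = {v, v̄}`, every `w ∈ S`
finitely decomposed; `corank_Λ S_{𝓛_v}(K, 𝐃₁) = 0`), the Shapiro descent `F` of `ψ : A ≃ M`, a finite
`S₀ ⊆ S` of places `w ≠ v` with `κ(D_w) = p^{a_w} ℤ_p` exactly, elements `σ_{w,i}` with `κ(σ_{w,i}) = i`.
Conclusion: for ANY `y_{w,i} ∈ H¹(ker κ ⊓ D_w, M)` there is `u ∈ H¹(ker κ, M)`, unramified at every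
`w ∉ S₀` with `w ∤ p`, locally trivial above every `w ∈ S` with `w ≠ v`, `w ∉ S₀`, and with
`res_{ker κ ⊓ D_w}(conj_{σ_{w,i}} u) = y_{w,i}` (`w ∈ S₀`, `i < p^{a_w}`): the local targets `[c'_w]` at
`w ∈ S₀` (local Shapiro surjectivity) and `0` at the other places `≠ v` are `φ_{𝓛_v}` of a global `ξ` by
`SUR(𝐃₁, 𝓛_v)`; `u = F ξ`. With `S₀ ∋ v̄` this is the surjectivity onto the local cohomology at the places
ABOVE `v̄` (Pollack–Weston's Prop. A.2 at `w = v̄`; KY Rem. 1.4.2).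
[cite: Greenberg2016Selmer, Prop. 2.6.3 and §1 p. 3] [cite: PollackWeston2011, App. A, Prop. A.2 (proof)]
[cite: KellerYin2024, Rem. 1.2.3 (ii) and Rem. 1.4.2 (arXiv:2402.12781v2 TeX L690–712, L1130–1140)]
[cite: SkinnerUrban2014, §3.1.2 and Prop. 3.2.3] -/
theorem exists_mem_unramifiedOutside_forall_resOfLe_conjH1_eq (h263 : prop263_sur_of_crk)
    (h41 : prop41_globalEulerPoincareCorank) (h42 : prop42_localEulerPoincareCorank)
    (h5A : sec5A_localH2_subsingleton_of_LOC1) (h32 : prop32_cohomology_isCofinitelyGenerated)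
    (hSf : S.Finite) (hK : IsImaginaryQuadratic K) (e : A ≃ₗ[ℤ_[p]] QpModZp p)
    (hscalar : ∀ g : GaloisGroupUnramifiedOutside K S, ∃ t : ℤ_[p]ˣ, ∀ a : A, ρ₀ g a = (t : ℤ_[p]) • a)
    (hsup : ∀ v : HeightOneSpectrum (𝓞 K), v ∈ S →
      ∃ σ : absoluteGaloisGroup (Place.Completion (Sum.inr v : Place K)),
        κ (absGaloisRestrict K _ σ) ≠ 1)
    {v vbar : HeightOneSpectrum (𝓞 K)} (hne : vbar ≠ v)
    (hv : ((p : ℕ) : 𝓞 K) ∈ v.asIdeal) (hvbar : ((p : ℕ) : 𝓞 K) ∈ vbar.asIdeal)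
    (hSel : HasCorank (PowerSeries ℤ_[p])
      (fullAtSpecification S (bigRep (κ.liftUnramifiedOutside S hS) ρ₀) (Sum.inr v)).selmer 0)
    (hSelfg : IsCofinitelyGenerated (PowerSeries ℤ_[p])
      (fullAtSpecification S (bigRep (κ.liftUnramifiedOutside S hS) ρ₀) (Sum.inr v)).selmer)
    (hA : ∀ a : A, ∃ k : ℕ, p ^ k • a = 0)
    {F : (bigRep (κ.liftUnramifiedOutside S hS) ρ₀).H 1 →+ subgroupH1 κ.kerSubgroup M}
    (hF : ∀ (c : contOneCocycles (bigRep (κ.liftUnramifiedOutside S hS) ρ₀).toTopRep)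
      (z : contOneCocycles (discreteTopRep κ.kerSubgroup M)),
      (∀ h : κ.kerSubgroup, z.1 h = ψ ((c.1 (toUnramifiedQuot K S h) : BigRepModule ℤ_[p] p A) 0)) →
      F (oneCocycleClass _ c) = oneCocycleClass _ z)
    (S₀ : Finset (HeightOneSpectrum (𝓞 K))) (hS₀S : ∀ w ∈ S₀, w ∈ S)
    (hS₀v : ∀ w ∈ S₀, w ≠ v) (a : HeightOneSpectrum (𝓞 K) → ℕ)
    (hdiv : ∀ w ∈ S₀, ∀ δ ∈ decomp (K := K) w, (p : ℤ_[p]) ^ a w ∣ (κ δ).toAdd)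
    (hd₀ : ∀ w ∈ S₀, ∃ δ ∈ decomp (K := K) w, (κ δ).toAdd = (p : ℤ_[p]) ^ a w)
    (σrep : HeightOneSpectrum (𝓞 K) → ℕ → absoluteGaloisGroup K)
    (hσrep : ∀ w ∈ S₀, ∀ i : ℕ, i < p ^ a w → (κ (σrep w i)).toAdd = (i : ℤ_[p]))
    (y : ∀ w : HeightOneSpectrum (𝓞 K), ℕ → subgroupH1 (κ.kerSubgroup ⊓ decomp (K := K) w) M) :
    ∃ u : subgroupH1 κ.kerSubgroup M,
      u ∈ unramifiedOutside κ.kerSubgroup M p (↑S₀ : Set (HeightOneSpectrum (𝓞 K))) ∧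
      (∀ w : HeightOneSpectrum (𝓞 K), w ∈ S → w ≠ v → w ∉ S₀ →
        ∀ σ : absoluteGaloisGroup K, conjH1 κ.kerSubgroup M σ u ∈ awayKer κ.kerSubgroup M w) ∧
      ∀ w ∈ S₀, ∀ i : ℕ, i < p ^ a w →
        resOfLe M (inf_le_left : κ.kerSubgroup ⊓ decomp (K := K) w ≤ κ.kerSubgroup)
          (conjH1 κ.kerSubgroup M (σrep w i) u) = y w i := by
  -- cocycle representatives of the targets
  have hζex : ∀ (w : HeightOneSpectrum (𝓞 K)) (i : ℕ),
      ∃ ζ : contOneCocycles (discreteTopRep ↥(κ.kerSubgroup ⊓ decomp (K := K) w) M),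
        oneCocycleClass _ ζ = y w i := fun w i ↦ oneCocycleClass_surjective _ _
  choose ζ hζ using hζex
  -- local cocycles at the places of `S₀` (local Shapiro surjectivity, place-agnostic)
  have hcls : ∀ w : HeightOneSpectrum (𝓞 K), w ∈ S₀ →
      ∃ c' : contOneCocycles (localRep S (bigRep (κ.liftUnramifiedOutside S hS) ρ₀) (Sum.inr w : Place K)).toTopRep,
        ∀ i : ℕ, i < p ^ a w →
          ∀ (x : ↥(κ.kerSubgroup ⊓ decomp (K := K) w)) (τ : absoluteGaloisGroup (w.adicCompletion K)),
            absGaloisRestrict K (w.adicCompletion K) τ = (x : absoluteGaloisGroup K) →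
            (ζ w i).1 x = ψ ((c'.1 τ : BigRepModule ℤ_[p] p A) (i : ℕ)) := fun w hw ↦
    exists_localCocycle_forall_eval S hS κ ρ₀ ψ hψ hA w (hdiv w hw) (hd₀ w hw) (ζ w)
  choose c' hc' using hcls
  -- the local targets: `[c'_w]` at `w ∈ S₀`, `0` elsewhere
  let xloc : ∀ w : HeightOneSpectrum (𝓞 K),
      (localRep S (bigRep (κ.liftUnramifiedOutside S hS) ρ₀) (Sum.inr w : Place K)).H 1 := fun w ↦
    if hw : w ∈ S₀ then oneCocycleClass _ (c' w hw) else 0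
  let xall : ∀ pl : Place K, (localRep S (bigRep (κ.liftUnramifiedOutside S hS) ρ₀) pl).H 1 := fun pl ↦
    @Sum.rec (InfinitePlace K) (HeightOneSpectrum (𝓞 K))
      (fun pl ↦ (localRep S (bigRep (κ.liftUnramifiedOutside S hS) ρ₀) pl).H 1)
      (fun _ ↦ 0) (fun w ↦ xloc w) pl
  let q : (fullAtSpecification S (bigRep (κ.liftUnramifiedOutside S hS) ρ₀) (Sum.inr v)).QGlobal := fun η ↦
    (fullAtSpecification S (bigRep (κ.liftUnramifiedOutside S hS) ρ₀) (Sum.inr v) η.1).mkQ (xall η.1)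
  -- `SUR(𝐃₁, 𝓛_v)`
  have hSUR : (fullAtSpecification S (bigRep (κ.liftUnramifiedOutside S hS) ρ₀) (Sum.inr v)).SUR :=
    bigRep_fullAt_SUR (S := S) (hS := hS) (κ := κ) (ρ₀ := ρ₀) h263 h41 h42 h5A h32 hSf hK e hscalar hsup hne
      hv hvbar hSel hSelfg
  obtain ⟨ξ, hξ⟩ := hSUR q
  obtain ⟨c, rfl⟩ := oneCocycleClass_surjective _ ξ
  -- the local components of `[c]` at the finite `w ∈ S`, `w ≠ v`
  have hcomp : ∀ w : HeightOneSpectrum (𝓞 K), w ∈ S → w ≠ v →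
      loc S (bigRep (κ.liftUnramifiedOutside S hS) ρ₀) (Sum.inr w) 1 (oneCocycleClass _ c) = xloc w := by
    intro w hwS hwv
    have hη := congrFun hξ ⟨Sum.inr w, (inSigma_inr_iff S w).mpr hwS⟩
    simp only [Specification.phi, LinearMap.pi_apply, LinearMap.coe_comp, Function.comp_apply, q, xall] at hη
    rw [Submodule.mkQ_apply, Submodule.mkQ_apply, Submodule.Quotient.eq,
      fullAtSpecification_of_ne (S := S) (ρ := bigRep (κ.liftUnramifiedOutside S hS) ρ₀)
        (η := (Sum.inr v : Place K)) (w := (Sum.inr w : Place K)) (fun h ↦ hwv (Sum.inr_injective h)),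
      Submodule.mem_bot, sub_eq_zero] at hη
    exact hη
  have hloc0 : ∀ w : HeightOneSpectrum (𝓞 K), w ∈ S → w ≠ v → w ∉ S₀ →
      loc S (bigRep (κ.liftUnramifiedOutside S hS) ρ₀) (Sum.inr w) 1 (oneCocycleClass _ c) = 0 := by
    intro w hwS hwv hw
    rw [hcomp w hwS hwv]
    exact dif_neg hw
  refine ⟨F (oneCocycleClass _ c), ?_, fun w hwS hwv hw σ ↦ ?_, fun w hw i hi ↦ ?_⟩
  · -- unramified outside `S₀ ∪ {w ∣ p}`
    rw [mem_unramifiedOutside_iff]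
    intro w hwS₀ hpw σ
    by_cases hwS : w ∈ S
    · have hwv : w ≠ v := fun h ↦ hpw (h ▸ hv)
      exact awayKer_le_unramifiedKer κ.kerSubgroup w
        (conjH1_shapiroDescent_mem_awayKer_of_loc_eq_zero S hS κ ρ₀ ψ hψ hA hF w c
          (hloc0 w hwS hwv fun h ↦ hwS₀ (Finset.mem_coe.mpr h)) σ)
    · exact conjH1_shapiroDescent_mem_unramifiedKer_of_not_mem S hS κ ρ₀ ψ hψ hF hwS c σ
  · -- locally trivial above the non-target places `w ∈ S ∖ ({v} ∪ S₀)`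
    exact conjH1_shapiroDescent_mem_awayKer_of_loc_eq_zero S hS κ ρ₀ ψ hψ hA hF w c (hloc0 w hwS hwv hw) σ
  · -- the local components at `S₀` are the evaluation classes
    have hcc' : loc S (bigRep (κ.liftUnramifiedOutside S hS) ρ₀) (Sum.inr w) 1 (oneCocycleClass _ c) =
        oneCocycleClass _ (c' w hw) := by
      rw [hcomp w (hS₀S w hw) (hS₀v w hw)]
      exact dif_pos hw
    rw [← hζ w i]
    refine resOfLe_conjH1_shapiroDescent_eq S hS κ ρ₀ ψ hψ hF w (σrep w i) c (c' w hw) hcc' (ζ w i)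
      fun x τ hτ ↦ ?_
    rw [hσrep w hw i hi]
    exact hc' w hw i hi x τ hτ

end SurAt

/-! ## §2 The instantiation at a character of the residual pair: SUR_θ at `v̄` -/

section ResidualPair

variable {K : Type} [Field K] [NumberField K] {p : ℕ} [Fact p.Prime]

/-- **SUR_θ AT `v̄` FROM THE FIVE GREENBERG FACTS + [RH], BY NAME.** Under Greenberg 2016 Prop. 2.6.3 and
Greenberg 2006 Props. 4.1, 4.2, §5 A, 3.2 (hypotheses BY NAME), for `W/ℚ`, `2 < p`, `K` imaginary quadratic
with (Heeg) for `N_E`, `v ≠ v̄` the places above `p` (`v` read through `ι : K →+* ℚ_p`), `κ` anticyclotomic with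
topological generator `γ`, `θ ∈ {θsub, θquot}` of a residual pair of `E[p]` over `K`, `Sf` the places over
`N_E`, and [RH] for `θ` (`H¹_{𝓕_nr}(K_∞, (F/𝒪)(θ))^∨` finitely generated `Λ`-torsion with `μ = 0`): there is
`c : ℕ` with `κ(D_v̄) = p^c ℤ_p` EXACTLY (`p^c = s` = the number of places of `K_∞` above `v̄`, whose
decomposition groups in `ker κ` are the `γ^{-i}(ker κ ⊓ D_v̄)γ^{i}`, `i < p^c`), and for EVERY family of local
classes `y i ∈ H¹(ker κ ⊓ D_v̄, (F/𝒪)(θ))` a class `u ∈ H¹(ker κ, (F/𝒪)(θ))` unramified outside `Sf ∪ {v, v̄}`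
(`u ∈ U((F/𝒪)(θ))` of the index road), locally trivial above every `w ∈ Sf` with `w ∤ p`, with
`res_{ker κ ⊓ D_v̄}(conj_{γ^i} u) = y i` for all `i < p^c` — the map `U(A_θ) → ⊕_{j<s} H¹(K_{∞,w_j}, A_θ)`
is ONTO. Proof: §1 with `S = {v, v̄} ∪ Sf`, `S₀ = {v̄}`, the model `ρ_θ` on `ℚ_p/ℤ_p` (`θ` unramified outside
`S` by Néron–Ogg–Shafarevich), the `σ`-supply (class field theory above `p`, Brink at `Sf`),
`corank_Λ S_{𝓛_v} = 0` from [RH] through the Shapiro descent, and `κ(γ^i) = i`.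
[cite: Greenberg2016Selmer, Prop. 2.6.3 (§2.6 p. 10)] [cite: Greenberg2006, Props. 3.2, 4.1, 4.2, §5 A]
[cite: PollackWeston2011, App. A Prop. A.2] [cite: KellerYin2024, Rem. 1.2.3 (ii), Rem. 1.4.2 (arXiv:2402.12781v2 TeX L690–712, L1130–1140)] -/
theorem exists_forall_resOfLe_conjH1_pow_eq_at_vbar_of_RH (h263 : prop263_sur_of_crk)
    (h41 : prop41_globalEulerPoincareCorank) (h42 : prop42_localEulerPoincareCorank)
    (h5A : sec5A_localH2_subsingleton_of_LOC1) (h32 : prop32_cohomology_isCofinitelyGenerated)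
    (W : WeierstrassCurve ℚ) [W.IsElliptic] (hp : 2 < p) (hK : IsImaginaryQuadratic K)
    (hH : SatisfiesHeegnerHypothesis (W.conductorNorm ℤ) K)
    {ι : K →+* ℚ_[p]} {v vbar : HeightOneSpectrum (𝓞 K)}
    (hvι : ∀ x : 𝓞 K, x ∈ v.asIdeal ↔ ‖ι (x : K)‖ < 1)
    (hvbar : ((p : ℕ) : 𝓞 K) ∈ vbar.asIdeal) (hne : vbar ≠ v)
    (κ : ZpExtension K p) (hκ : κ.IsAnticyclotomic) (γ : absoluteGaloisGroup K)
    [Fact (κ.IsTopGenerator γ)]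
    {θsub θquot : FramedGaloisRep K (padicCoeffIntegers (∅ : Set (PadicAlgCl p))) 1}
    (hpair : IsResidualPairOver (W.baseChange K) p θsub θquot)
    (Sf : Finset (HeightOneSpectrum (𝓞 K)))
    (hSf : ∀ w : HeightOneSpectrum (𝓞 K), w ∈ Sf ↔ ((W.conductorNorm ℤ : ℤ) : 𝓞 K) ∈ w.asIdeal)
    (θ : FramedGaloisRep K (padicCoeffIntegers (∅ : Set (PadicAlgCl p))) 1) (hθ : θ = θsub ∨ θ = θquot)
    (hRH : ∀ D : DatumDualData κ γ (charModule (∅ : Set (PadicAlgCl p)) θ)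
        (Castella2018.AcSelmer.bdpData (charModule (∅ : Set (PadicAlgCl p)) θ) p vbar)
        (∅ : Set (HeightOneSpectrum (𝓞 K))),
      Module.Finite (IwasawaAlgebra p) D.X ∧ Module.IsTorsion (IwasawaAlgebra p) D.X ∧
        muInvariant p D.X = 0) :
    ∃ c : ℕ, (∃ δ ∈ decomp (K := K) vbar, (κ δ).toAdd = (p : ℤ_[p]) ^ c) ∧
      (∀ δ ∈ decomp (K := K) vbar, (p : ℤ_[p]) ^ c ∣ (κ δ).toAdd) ∧
      ∀ y : ℕ → subgroupH1 (κ.kerSubgroup ⊓ decomp (K := K) vbar) (charModule (∅ : Set (PadicAlgCl p)) θ),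
        ∃ u ∈ unramifiedOutside κ.kerSubgroup (charModule (∅ : Set (PadicAlgCl p)) θ) p
            (↑Sf : Set (HeightOneSpectrum (𝓞 K))),
          (∀ w ∈ Sf, ((p : ℕ) : 𝓞 K) ∉ w.asIdeal → ∀ σ : absoluteGaloisGroup K,
            conjH1 κ.kerSubgroup (charModule (∅ : Set (PadicAlgCl p)) θ) σ u ∈
              awayKer κ.kerSubgroup (charModule (∅ : Set (PadicAlgCl p)) θ) w) ∧
          ∀ i : ℕ, i < p ^ c →
            resOfLe (charModule (∅ : Set (PadicAlgCl p)) θ)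
              (inf_le_left : κ.kerSubgroup ⊓ decomp (K := K) vbar ≤ κ.kerSubgroup)
              (conjH1 κ.kerSubgroup (charModule (∅ : Set (PadicAlgCl p)) θ) (γ ^ i) u) = y i := by
  have hγ : κ.IsTopGenerator γ := Fact.out
  have hv : ((p : ℕ) : 𝓞 K) ∈ v.asIdeal := IwasawaTwoVariable.natCast_mem_asIdeal_of_norm_iff hvι
  have hSp : ∀ w : HeightOneSpectrum (𝓞 K), ((p : ℕ) : 𝓞 K) ∈ w.asIdeal → w = v ∨ w = vbar :=
    fun w hw ↦ eq_or_eq_of_natCast_mem_of_ne hK.1 hv hvbar hne hw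
  -- `v̄` is finitely decomposed in `K_∞`: `κ(D_v̄) = p^c ℤ_p` exactly
  have hdec : ¬ decomp (K := K) vbar ≤ κ.kerSubgroup := fun hle ↦ by
    obtain ⟨σ, hσ⟩ := exists_local_apply_ne_one_of_natCast_mem hK κ hvbar
    exact hσ (ZpExtension.mem_kerSubgroup.mp (hle ((mem_decomp_iff vbar _).mpr ⟨σ, rfl⟩)))
  obtain ⟨c, ⟨d₀, hd₀⟩, -, hdvd⟩ :=
    UniversalToricDescentSigmaLocalStabilizer.exists_pow_and_forall_dvd_of_not_le κ vbar hdec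
  have hd₀' : ∃ δ ∈ decomp (K := K) vbar, (κ δ).toAdd = (p : ℤ_[p]) ^ c := ⟨d₀, d₀.2, hd₀⟩
  have hdiv' : ∀ δ ∈ decomp (K := K) vbar, (p : ℤ_[p]) ^ c ∣ (κ δ).toAdd := fun δ hδ ↦ hdvd ⟨δ, hδ⟩
  refine ⟨c, hd₀', hdiv', fun y ↦ ?_⟩
  -- the target family, supported at `v̄`
  let y' : ∀ w : HeightOneSpectrum (𝓞 K), ℕ →
      subgroupH1 (κ.kerSubgroup ⊓ decomp (K := K) w) (charModule (∅ : Set (PadicAlgCl p)) θ) :=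
    fun w i ↦ if hw : w = vbar then hw ▸ y i else 0
  have hy' : ∀ i : ℕ, y' vbar i = y i := fun i ↦ by simp [y']
  -- the representatives `γ^i` of the places above `v̄`: `κ(γ^i) = i`
  have hσrep : ∀ w ∈ ({vbar} : Finset (HeightOneSpectrum (𝓞 K))), ∀ i : ℕ, i < p ^ (fun _ ↦ c) w →
      (κ ((fun (_ : HeightOneSpectrum (𝓞 K)) (i : ℕ) ↦ γ ^ i) w i)).toAdd = (i : ℤ_[p]) := fun w _ i _ ↦ by
    change (κ (γ ^ i)).toAdd = (i : ℤ_[p])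
    rw [map_pow, show κ γ = Multiplicative.ofAdd 1 from hγ, ← ofAdd_nsmul, toAdd_ofAdd, nsmul_one]
  -- `S = {v, v̄} ∪ Sf`; `θ` is unramified outside `S`
  have hS : ∀ w : HeightOneSpectrum (𝓞 K), ((p : ℕ) : 𝓞 K) ∈ w.asIdeal →
      w ∈ (↑(insert v (insert vbar Sf)) : Set (HeightOneSpectrum (𝓞 K))) :=
    mem_insert_insert_of_natCast_mem hK hv hvbar hne Sf
  have hSfS : ∀ w ∈ Sf, w ∈ (↑(insert v (insert vbar Sf)) : Set (HeightOneSpectrum (𝓞 K))) :=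
    fun w hw ↦ by
    rw [Finset.coe_insert, Finset.coe_insert]
    exact Or.inr (Or.inr (Finset.mem_coe.mpr hw))
  have h : ramificationSubgroup K (↑(insert v (insert vbar Sf)) : Set (HeightOneSpectrum (𝓞 K))) ≤
      (unitChar θ).toMonoidHom.ker :=
    ramificationSubgroup_le_ker_unitChar_of_residualPair W hpair Sf hSf _ hSfS hS θ hθ
  -- the canonical (discrete) topological instances of the model
  letI tΛ : TopologicalSpace (PowerSeries ℤ_[p]) := ⊥
  haveI : DiscreteTopology (PowerSeries ℤ_[p]) := ⟨rfl⟩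
  haveI : IsTopologicalRing (PowerSeries ℤ_[p]) := inferInstance
  haveI hAdisc : DiscreteTopology (QpModZp p) := QpModZp.discreteTopology p
  haveI : IsTopologicalAddGroup (BigRepModule ℤ_[p] p (QpModZp p)) := inferInstance
  haveI : ContinuousSMul (PowerSeries ℤ_[p]) (BigRepModule ℤ_[p] p (QpModZp p)) := inferInstance
  -- the model `ρ_θ` on `ℚ_p/ℤ_p`, `ψ = (charModuleEquiv θ)⁻¹`, the Shapiro descent `F`, and [RH]
  have hψ := charModuleEquiv_symm_galois (↑(insert v (insert vbar Sf)) : Set (HeightOneSpectrum (𝓞 K))) θ h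
  obtain ⟨F, hF⟩ := exists_shapiroDescent _ hS κ (characterRepUnramified _ θ h) (charModuleEquiv θ).symm hψ
  obtain ⟨hSel, hSelfg⟩ := hasCorank_fullAtSelmer_zero_of_RH hK κ hγ hv hvbar hne θ _ hS h hRH
  -- §1 with `S₀ = {v̄}`
  have hvbarS : ∀ w ∈ ({vbar} : Finset (HeightOneSpectrum (𝓞 K))),
      w ∈ (↑(insert v (insert vbar Sf)) : Set (HeightOneSpectrum (𝓞 K))) := fun w hw ↦ by
    rw [Finset.mem_singleton] at hw
    subst hw
    exact hS w hvbar
  have hvbarv : ∀ w ∈ ({vbar} : Finset (HeightOneSpectrum (𝓞 K))), w ≠ v := fun w hw ↦ by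
    rw [Finset.mem_singleton] at hw
    subst hw
    exact hne
  obtain ⟨u, hunr, haway, hev⟩ := exists_mem_unramifiedOutside_forall_resOfLe_conjH1_eq _ hS κ
    (characterRepUnramified _ θ h) (charModuleEquiv θ).symm hψ h263 h41 h42 h5A h32 (Finset.finite_toSet _) hK
    (LinearEquiv.refl ℤ_[p] (QpModZp p)) (characterRepUnramified_hscalar _ θ h)
    (exists_local_apply_ne_one_of_mem_insert_insert hK hp hH κ hκ hv hvbar Sf hSf)
    hne hv hvbar hSel hSelfg (fun b ↦ QpModZp.exists_pow_nsmul_eq_zero b) hF {vbar} hvbarS hvbarv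
    (fun _ ↦ c) (fun w hw ↦ by rw [Finset.mem_singleton] at hw; subst hw; exact hdiv')
    (fun w hw ↦ by rw [Finset.mem_singleton] at hw; subst hw; exact hd₀') (fun _ i ↦ γ ^ i) hσrep y'
  refine ⟨u, ?_, fun w hw hpw σ ↦ ?_, fun i hi ↦ (hev vbar (Finset.mem_singleton_self vbar) i hi).trans (hy' i)⟩
  · -- unramified outside `{v̄} ∪ {w ∣ p}` ⇒ unramified outside `Sf ∪ {w ∣ p}`
    rw [mem_unramifiedOutside_iff] at hunr ⊢
    intro w _ hpw σ
    exact hunr w (fun hw ↦ hpw (by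
      rw [Finset.coe_singleton, Set.mem_singleton_iff] at hw
      exact hw ▸ hvbar)) hpw σ
  · -- locally trivial above `w ∈ Sf`, `w ∤ p` (so `w ≠ v, v̄`)
    refine haway w (hSfS w hw) (fun h' ↦ hpw (h' ▸ hv)) (fun hw' ↦ ?_) σ
    rw [Finset.mem_singleton] at hw'
    exact hpw (hw' ▸ hvbar)

end ResidualPair

end Summit.BirchSwinnertonDyer.BirchSwinnertonDyer.Theorems.AcTwistDeformation

end
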